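import Mathlib
import Summits.Ventures.PercRepro.TriangleCapRowStair

/-!
# PercRepro — THE PAIR WITNESS: OFF-PAIRS WITH BOTH ENDS FREE (p3, gen 51; part 245)

`genWitness n a r t lf rf` is `K_{a, n−a}` minus the `(r − t)`-star at `0` minus the `t` cross pairs
`{lf i, rf i}` (`i < t`) with BOTH ends free: `1 ≤ lf i < a ≤ rf i < n` and the pairs distinct
(`i ↦ (lf i, rf i)` injective on `range t`).  The row witness (part 237) is the case `rf = rEnd`; now right ends may
repeat, so the missing graph may contain paths through right vertices.  Structure: `K₄⁻`-free, `a`-bipartite, the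
missing graph `H` has `deg H 0 = r − t` (neighbourhood `rightStar n a (r − t)`), `offEdges H 0` = the `t` pairs,
`attach H 0 = #{i < t : rf i < a + (r − t)}` (the pairs ending at a leaf), and
`offAdjPairs H 0 = coll t lf + coll t rf` (two pairs share a vertex iff they share their left end or their right
end, never both).  Hence (`genWitness_missing_value`)
`Σ_H d² + 2 t (r − t − 1) + (2 (t − attach) + (t (t − 1) − coll t lf − coll t rf)) = r (r + 1)`.  Axioms: standard.
-/

namespace PercRepro

namespace TriangleCap

namespace C047

open Finset

/-- The `i`-th pair. -/
def genPair (n : ℕ) (hn : 0 < n) (lf rf : ℕ → ℕ) (i : ℕ) : Sym2 (Fin n) := s(fin' n hn (lf i), fin' n hn (rf i))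

/-- The `t` pairs. -/
def genPairs (n t : ℕ) (hn : 0 < n) (lf rf : ℕ → ℕ) : Finset (Sym2 (Fin n)) := (range t).image (genPair n hn lf rf)

/-- **THE PAIR WITNESS:** `K_{a, n−a}` minus the `(r − t)`-star at `0` minus the `t` pairs. -/
def genWitness (n a r t : ℕ) (hn : 0 < n) (lf rf : ℕ → ℕ) : SimpleGraph (Fin n) :=
  delEdges (bipMinusStar n a (r - t)) (genPairs n t hn lf rf)

/-- Adjacency in the pair witness is decidable. -/
instance decidableRelGenWitness (n a r t : ℕ) (hn : 0 < n) (lf rf : ℕ → ℕ) :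
    DecidableRel (genWitness n a r t hn lf rf).Adj :=
  inferInstanceAs (DecidableRel (delEdges (bipMinusStar n a (r - t)) (genPairs n t hn lf rf)).Adj)

/-- The standing hypotheses on the ends: `1 ≤ lf i < a ≤ rf i < n` for `i < t`, and the pairs distinct. -/
def GoodEnds (n a t : ℕ) (lf rf : ℕ → ℕ) : Prop :=
  (∀ i, i < t → 1 ≤ lf i ∧ lf i < a) ∧ (∀ i, i < t → a ≤ rf i ∧ rf i < n) ∧
    ∀ i i', i < t → i' < t → lf i = lf i' → rf i = rf i' → i = i'

/-- Membership in the `i`-th pair (`i < t`). -/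
theorem mem_genPair_iff (n a t : ℕ) (hn : 0 < n) (lf rf : ℕ → ℕ) (hg : GoodEnds n a t lf rf) (i : ℕ) (hi : i < t)
    (han : a ≤ n) (v : Fin n) : v ∈ genPair n hn lf rf i ↔ v.val = lf i ∨ v.val = rf i := by
  unfold genPair
  rw [Sym2.mem_iff, Fin.ext_iff, Fin.ext_iff, fin'_val n hn _ (by have := hg.1 i hi; omega),
    fin'_val n hn _ (hg.2.1 i hi).2]

/-- The vertex `0` lies in no pair. -/
theorem zero_notMem_genPair (n a t : ℕ) (hn : 0 < n) (lf rf : ℕ → ℕ) (hg : GoodEnds n a t lf rf) (i : ℕ)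
    (hi : i < t) (han : a ≤ n) : fin' n hn 0 ∉ genPair n hn lf rf i := by
  rw [mem_genPair_iff n a t hn lf rf hg i hi han, fin'_val n hn 0 hn]
  have h1 := hg.1 i hi
  have h2 := hg.2.1 i hi
  omega

/-- Two pairs (`i, i' < t`) agree iff their indices agree. -/
theorem genPair_eq_iff (n a t : ℕ) (hn : 0 < n) (lf rf : ℕ → ℕ) (hg : GoodEnds n a t lf rf) (i i' : ℕ) (hi : i < t)
    (hi' : i' < t) (han : a ≤ n) : genPair n hn lf rf i = genPair n hn lf rf i' ↔ i = i' := by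
  constructor
  · intro h
    unfold genPair at h
    rw [Sym2.eq_iff, Fin.ext_iff, Fin.ext_iff, Fin.ext_iff, Fin.ext_iff,
      fin'_val n hn _ (by have := hg.1 i hi; omega), fin'_val n hn _ (hg.2.1 i hi).2,
      fin'_val n hn _ (by have := hg.1 i' hi'; omega), fin'_val n hn _ (hg.2.1 i' hi').2] at h
    rcases h with ⟨h1, h2⟩ | ⟨h1, -⟩
    · exact hg.2.2 i i' hi hi' h1 h2
    · have := hg.1 i hi
      have := hg.2.1 i' hi'
      omega
  · rintro rfl
    rfl

/-- Membership in the pairs. -/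
theorem mem_genPairs (n t : ℕ) (hn : 0 < n) (lf rf : ℕ → ℕ) (e : Sym2 (Fin n)) :
    e ∈ genPairs n t hn lf rf ↔ ∃ i, i < t ∧ genPair n hn lf rf i = e := by
  unfold genPairs
  simp only [mem_image, mem_range]

/-- **`|genPairs| = t`.** -/
theorem card_genPairs (n a t : ℕ) (hn : 0 < n) (lf rf : ℕ → ℕ) (hg : GoodEnds n a t lf rf) (han : a ≤ n) :
    (genPairs n t hn lf rf).card = t := by
  unfold genPairs
  rw [card_image_of_injOn, card_range]
  intro i hi i' hi' h
  simp only [coe_range, Set.mem_Iio] at hi hi'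
  exact (genPair_eq_iff n a t hn lf rf hg i i' hi hi' han).mp h

/-- A pair is a cross pair not at `0`. -/
theorem genPair_cross (n a t : ℕ) (hn : 0 < n) (lf rf : ℕ → ℕ) (hg : GoodEnds n a t lf rf) (han : a ≤ n)
    (x y : Fin n) (h : s(x, y) ∈ genPairs n t hn lf rf) :
    (1 ≤ x.val ∧ x.val < a ∧ a ≤ y.val) ∨ (1 ≤ y.val ∧ y.val < a ∧ a ≤ x.val) := by
  rw [mem_genPairs] at h
  obtain ⟨i, hi, he⟩ := h
  unfold genPair at he
  rw [Sym2.eq_iff, Fin.ext_iff, Fin.ext_iff, Fin.ext_iff, Fin.ext_iff,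
    fin'_val n hn _ (by have := hg.1 i hi; omega), fin'_val n hn _ (hg.2.1 i hi).2] at he
  have h1 := hg.1 i hi
  have h3 := hg.2.1 i hi
  rcases he with ⟨hx, hy⟩ | ⟨hx, hy⟩
  · left; omega
  · right; omega

/-- The pair witness is `K₄⁻`-free. -/
theorem k4mFree_genWitness (n a r t : ℕ) (hn : 0 < n) (lf rf : ℕ → ℕ) : K4mFree (genWitness n a r t hn lf rf) :=
  k4mFree_of_le _ _ (delEdges_le _ _) (k4mFree_bipMinusStar n a (r - t))

/-- The pair witness is a spanning subgraph of `K(A, Aᶜ)`, `A = {i < a}`. -/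
theorem bipSub_genWitness (n a r t : ℕ) (hn : 0 < n) (lf rf : ℕ → ℕ) :
    BipSub (genWitness n a r t hn lf rf) (leftPart n a) :=
  fun x y h => bipMinusStar_bipartite n a (r - t) x y h.1

/-- Adjacency in the missing graph of the pair witness on a cross pair `x < a ≤ y`. -/
theorem missingGraph_genWitness_adj (n a r t : ℕ) (hn : 0 < n) (lf rf : ℕ → ℕ) (x y : Fin n) (hx : x.val < a)
    (hy : a ≤ y.val) :
    (missingGraph (genWitness n a r t hn lf rf) (leftPart n a)).Adj x y ↔
      (x.val = 0 ∧ y.val < a + (r - t)) ∨ s(x, y) ∈ genPairs n t hn lf rf := by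
  rw [missingGraph_adj]
  unfold genWitness
  rw [delEdges_adj, bipMinusStar_adj]
  simp only [leftPart, mem_filter, mem_univ, true_and]
  constructor
  · rintro ⟨-, h⟩
    by_cases hS : s(x, y) ∈ genPairs n t hn lf rf
    · exact Or.inr hS
    · left
      by_contra hc
      apply h
      refine ⟨⟨Or.inl ⟨hx, by omega⟩, ?_⟩, hS⟩
      rintro (⟨h1, h2, h3⟩ | ⟨h1, -, -⟩)
      · exact hc ⟨h1, h3⟩
      · omega
  · intro h
    refine ⟨⟨fun _ => by omega, fun _ => hx⟩, ?_⟩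
    rintro ⟨⟨-, h2⟩, hS⟩
    rcases h with ⟨h1, h3⟩ | h
    · exact h2 (Or.inl ⟨h1, hy, h3⟩)
    · exact hS h

/-- The neighbourhood of `0` in the missing graph is the star `rightStar n a (r − t)`. -/
theorem filter_adj_missingGraph_genWitness (n a r t : ℕ) (hn : 0 < n) (lf rf : ℕ → ℕ) (hg : GoodEnds n a t lf rf)
    (ha : 1 ≤ a) (han : a ≤ n) :
    univ.filter (fun v => (missingGraph (genWitness n a r t hn lf rf) (leftPart n a)).Adj (fin' n hn 0) v) =
      rightStar n a (r - t) := by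
  ext v
  simp only [mem_filter, mem_univ, true_and, rightStar]
  by_cases hv : v.val < a
  · rw [missingGraph_adj]
    simp only [leftPart, mem_filter, mem_univ, true_and, fin'_val n hn 0 hn]
    constructor
    · rintro ⟨h, -⟩
      exact absurd hv ((h.mp (by omega)))
    · intro h; omega
  · rw [missingGraph_genWitness_adj n a r t hn lf rf _ v (by rw [fin'_val n hn 0 hn]; omega) (by omega),
      fin'_val n hn 0 hn]
    constructor
    · rintro (⟨-, h⟩ | h)
      · exact ⟨by omega, h⟩
      · exfalso
        rw [mem_genPairs] at h
        obtain ⟨i, hi, he⟩ := h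
        have := zero_notMem_genPair n a t hn lf rf hg i hi han
        rw [he] at this
        exact this (Sym2.mem_mk_left _ _)
    · rintro ⟨-, h⟩
      exact Or.inl ⟨rfl, h⟩

/-- `deg H 0 = r − t` in the missing graph of the pair witness (`a + (r − t) ≤ n`). -/
theorem deg_missingGraph_genWitness_zero (n a r t : ℕ) (hn : 0 < n) (lf rf : ℕ → ℕ) (hg : GoodEnds n a t lf rf)
    (ha : 1 ≤ a) (han : a + (r - t) ≤ n) :
    deg (missingGraph (genWitness n a r t hn lf rf) (leftPart n a)) (fin' n hn 0) = r - t := by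
  unfold deg
  rw [filter_adj_missingGraph_genWitness n a r t hn lf rf hg ha (by omega), card_rightStar n a (r - t) han]

/-- The off-edges of `0` in the missing graph are exactly the pairs. -/
theorem offEdges_missingGraph_genWitness (n a r t : ℕ) (hn : 0 < n) (lf rf : ℕ → ℕ) (hg : GoodEnds n a t lf rf)
    (han : a ≤ n) :
    offEdges (missingGraph (genWitness n a r t hn lf rf) (leftPart n a)) (fin' n hn 0) = genPairs n t hn lf rf := by
  ext e
  rw [mem_offEdges, SimpleGraph.mem_edgeFinset]
  refine Sym2.ind (fun x y => ?_) e
  rw [SimpleGraph.mem_edgeSet, Sym2.mem_iff]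
  constructor
  · rintro ⟨hadj, h0⟩
    have hcross := (missingGraph_adj _ _ x y).mp hadj
    simp only [leftPart, mem_filter, mem_univ, true_and] at hcross
    have h0x : x.val ≠ 0 := fun h => h0 (Or.inl (Fin.ext (by rw [fin'_val n hn 0 hn]; exact h.symm)))
    have h0y : y.val ≠ 0 := fun h => h0 (Or.inr (Fin.ext (by rw [fin'_val n hn 0 hn]; exact h.symm)))
    by_cases hx : x.val < a
    · have hy : a ≤ y.val := by
        have := hcross.1.mp hx
        omega
      rcases (missingGraph_genWitness_adj n a r t hn lf rf x y hx hy).mp hadj with ⟨h1, -⟩ | h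
      · exact absurd h1 h0x
      · exact h
    · have hy : y.val < a := by
        by_contra hy
        exact hx (hcross.1.mpr hy)
      rcases (missingGraph_genWitness_adj n a r t hn lf rf y x hy (by omega)).mp
        ((missingGraph _ _).adj_symm hadj) with ⟨h1, -⟩ | h
      · exact absurd h1 h0y
      · rw [Sym2.eq_swap]
        exact h
  · intro h
    have hc := genPair_cross n a t hn lf rf hg han x y h
    refine ⟨?_, ?_⟩
    · rcases hc with ⟨h1, h2, h3⟩ | ⟨h1, h2, h3⟩
      · exact (missingGraph_genWitness_adj n a r t hn lf rf x y h2 h3).mpr (Or.inr h)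
      · exact (missingGraph _ _).adj_symm
          ((missingGraph_genWitness_adj n a r t hn lf rf y x h2 h3).mpr (Or.inr (by rw [Sym2.eq_swap]; exact h)))
    · rintro (hx | hy)
      · rw [Fin.ext_iff, fin'_val n hn 0 hn] at hx
        omega
      · rw [Fin.ext_iff, fin'_val n hn 0 hn] at hy
        omega

/-- The missing graph has `r` edges (`t ≤ r`, `a + (r − t) ≤ n`). -/
theorem card_edges_missingGraph_genWitness (n a r t : ℕ) (hn : 0 < n) (lf rf : ℕ → ℕ) (hg : GoodEnds n a t lf rf)
    (ha : 1 ≤ a) (ht : t ≤ r) (han : a + (r - t) ≤ n) :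
    (missingGraph (genWitness n a r t hn lf rf) (leftPart n a)).edgeFinset.card = r := by
  have h := card_offEdges_add_deg (missingGraph (genWitness n a r t hn lf rf) (leftPart n a)) (fin' n hn 0)
  rw [offEdges_missingGraph_genWitness n a r t hn lf rf hg (by omega), card_genPairs n a t hn lf rf hg (by omega),
    deg_missingGraph_genWitness_zero n a r t hn lf rf hg ha han] at h
  omega

/-- **`attach` counts the pairs ending at a leaf:** `attach H 0 = #{i < t : rf i < a + (r − t)}`. -/
theorem attach_genWitness (n a r t : ℕ) (hn : 0 < n) (lf rf : ℕ → ℕ) (hg : GoodEnds n a t lf rf) (ha : 1 ≤ a)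
    (han : a ≤ n) :
    attach (missingGraph (genWitness n a r t hn lf rf) (leftPart n a)) (fin' n hn 0) =
      ((range t).filter (fun i => rf i < a + (r - t))).card := by
  have hN := filter_adj_missingGraph_genWitness n a r t hn lf rf hg ha han
  have hmem : ∀ v, (missingGraph (genWitness n a r t hn lf rf) (leftPart n a)).Adj (fin' n hn 0) v ↔
      a ≤ v.val ∧ v.val < a + (r - t) := by
    intro v
    rw [Finset.ext_iff] at hN
    have := hN v
    simpa only [mem_filter, mem_univ, true_and, rightStar] using this
  rw [attach_eq_sum_card, offEdges_missingGraph_genWitness n a r t hn lf rf hg han]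
  unfold genPairs
  rw [sum_image (fun i hi i' hi' h => by
    simp only [coe_range, Set.mem_Iio] at hi hi'
    exact (genPair_eq_iff n a t hn lf rf hg i i' hi hi' han).mp h)]
  have hterm : ∀ i ∈ range t,
      (univ.filter (fun v => (missingGraph (genWitness n a r t hn lf rf) (leftPart n a)).Adj (fin' n hn 0) v ∧
        v ∈ genPair n hn lf rf i)).card = if rf i < a + (r - t) then 1 else 0 := by
    intro i hi
    rw [mem_range] at hi
    have h1 := hg.1 i hi
    have h2 := hg.2.1 i hi
    by_cases him : rf i < a + (r - t)
    · rw [if_pos him]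
      have : univ.filter (fun v => (missingGraph (genWitness n a r t hn lf rf) (leftPart n a)).Adj (fin' n hn 0) v ∧
          v ∈ genPair n hn lf rf i) = {fin' n hn (rf i)} := by
        ext v
        simp only [mem_filter, mem_univ, true_and, mem_singleton, hmem,
          mem_genPair_iff n a t hn lf rf hg i hi han, Fin.ext_iff, fin'_val n hn _ h2.2]
        omega
      rw [this, card_singleton]
    · rw [if_neg him]
      rw [card_eq_zero, filter_eq_empty_iff]
      intro v _
      simp only [hmem, mem_genPair_iff n a t hn lf rf hg i hi han]
      omega
  rw [sum_congr rfl hterm, sum_boole, Nat.cast_id]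

/-- **`offAdjPairs = coll t lf + coll t rf`:** two pairs share a vertex iff they share their left end or their
right end (never both). -/
theorem offAdjPairs_genWitness (n a r t : ℕ) (hn : 0 < n) (lf rf : ℕ → ℕ) (hg : GoodEnds n a t lf rf)
    (han : a ≤ n) :
    offAdjPairs (missingGraph (genWitness n a r t hn lf rf) (leftPart n a)) (fin' n hn 0) = coll t lf + coll t rf := by
  unfold offAdjPairs
  rw [offEdges_missingGraph_genWitness n a r t hn lf rf hg han]
  unfold genPairs
  have hinj : Set.InjOn (genPair n hn lf rf) ↑(range t) := fun i hi i' hi' h => by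
    simp only [coe_range, Set.mem_Iio] at hi hi'
    exact (genPair_eq_iff n a t hn lf rf hg i i' hi hi' han).mp h
  have hinj2 : Set.InjOn (Prod.map (genPair n hn lf rf) (genPair n hn lf rf)) ↑((range t).offDiag) := by
    intro p hp p' hp' h
    simp only [coe_offDiag, Set.mem_offDiag, coe_range, Set.mem_Iio] at hp hp'
    rw [Prod.ext_iff] at h ⊢
    exact ⟨(genPair_eq_iff n a t hn lf rf hg _ _ hp.1 hp'.1 han).mp h.1,
      (genPair_eq_iff n a t hn lf rf hg _ _ hp.2.1 hp'.2.1 han).mp h.2⟩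
  rw [offDiag_image_of_injOn hinj, card_filter_image_of_injOn hinj2]
  -- the sharing pairs split into the left-end collisions and the right-end collisions
  have hsplit : (range t).offDiag.filter (fun p : ℕ × ℕ =>
      ∃ v ∈ (Prod.map (genPair n hn lf rf) (genPair n hn lf rf) p).1,
        v ∈ (Prod.map (genPair n hn lf rf) (genPair n hn lf rf) p).2) =
      (range t).offDiag.filter (fun p : ℕ × ℕ => lf p.1 = lf p.2) ∪
        (range t).offDiag.filter (fun p : ℕ × ℕ => rf p.1 = rf p.2) := by
    ext p
    simp only [mem_filter, Prod.map_fst, Prod.map_snd, mem_union]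
    constructor
    · rintro ⟨hp, v, hv1, hv2⟩
      rw [mem_offDiag] at hp
      obtain ⟨hp1, hp2, hp12⟩ := hp
      rw [mem_range] at hp1 hp2
      have h1 := hg.1 p.1 hp1
      have h2 := hg.1 p.2 hp2
      have h3 := hg.2.1 p.1 hp1
      have h4 := hg.2.1 p.2 hp2
      rw [mem_genPair_iff n a t hn lf rf hg _ hp1 han] at hv1
      rw [mem_genPair_iff n a t hn lf rf hg _ hp2 han] at hv2
      rcases hv1 with hv1 | hv1 <;> rcases hv2 with hv2 | hv2
      · left; exact ⟨mem_offDiag.mpr ⟨mem_range.mpr hp1, mem_range.mpr hp2, hp12⟩, by omega⟩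
      · omega
      · omega
      · right; exact ⟨mem_offDiag.mpr ⟨mem_range.mpr hp1, mem_range.mpr hp2, hp12⟩, by omega⟩
    · rintro (⟨hp, h⟩ | ⟨hp, h⟩)
      · refine ⟨hp, ?_⟩
        rw [mem_offDiag] at hp
        obtain ⟨hp1, hp2, -⟩ := hp
        rw [mem_range] at hp1 hp2
        have h1 := hg.1 p.1 hp1
        refine ⟨fin' n hn (lf p.1), ?_, ?_⟩
        · rw [mem_genPair_iff n a t hn lf rf hg _ hp1 han, fin'_val n hn _ (by omega)]
          exact Or.inl rfl
        · rw [mem_genPair_iff n a t hn lf rf hg _ hp2 han, fin'_val n hn _ (by omega)]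
          exact Or.inl h
      · refine ⟨hp, ?_⟩
        rw [mem_offDiag] at hp
        obtain ⟨hp1, hp2, -⟩ := hp
        rw [mem_range] at hp1 hp2
        have h3 := hg.2.1 p.1 hp1
        refine ⟨fin' n hn (rf p.1), ?_, ?_⟩
        · rw [mem_genPair_iff n a t hn lf rf hg _ hp1 han, fin'_val n hn _ h3.2]
          exact Or.inr rfl
        · rw [mem_genPair_iff n a t hn lf rf hg _ hp2 han, fin'_val n hn _ h3.2]
          exact Or.inr h
  have hdisj : Disjoint ((range t).offDiag.filter (fun p : ℕ × ℕ => lf p.1 = lf p.2))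
      ((range t).offDiag.filter (fun p : ℕ × ℕ => rf p.1 = rf p.2)) := by
    rw [disjoint_left]
    intro p hp hp'
    rw [mem_filter, mem_offDiag, mem_range, mem_range] at hp hp'
    exact hp.1.2.2 (hg.2.2 p.1 p.2 hp.1.1 hp.1.2.1 hp.2 hp'.2)
  have hc := congrArg Finset.card hsplit
  rw [card_union_of_disjoint hdisj] at hc
  convert hc using 2
  all_goals first | rfl | exact Finset.filter_congr_decidable _ _ _

/-- **THE VALUE OF THE MISSING GRAPH OF THE PAIR WITNESS** (`1 ≤ t ≤ r`, `t + 1 ≤ r`, `a + (r − t) ≤ n`): with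
`att = #{i < t : rf i < a + (r − t)}` and `P = coll t lf + coll t rf`,
`Σ_H d² + 2 t (r − t − 1) + (2 (t − att) + (t (t − 1) − P)) = r (r + 1)`. -/
theorem genWitness_missing_value (n a r t : ℕ) (hn : 0 < n) (lf rf : ℕ → ℕ) (hg : GoodEnds n a t lf rf)
    (ha : 1 ≤ a) (ht : 1 ≤ t) (hr1 : t + 1 ≤ r) (han : a + (r - t) ≤ n) :
    ∑ v, deg (missingGraph (genWitness n a r t hn lf rf) (leftPart n a)) v *
        deg (missingGraph (genWitness n a r t hn lf rf) (leftPart n a)) v +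
      2 * (t * (r - t - 1)) + (2 * (t - ((range t).filter (fun i => rf i < a + (r - t))).card) +
        (t * (t - 1) - (coll t lf + coll t rf))) = r * (r + 1) := by
  have hdec := sum_deg_sq_vertex_decomposition (missingGraph (genWitness n a r t hn lf rf) (leftPart n a))
    (fin' n hn 0)
  rw [deg_missingGraph_genWitness_zero n a r t hn lf rf hg ha han,
    offEdges_missingGraph_genWitness n a r t hn lf rf hg (by omega), card_genPairs n a t hn lf rf hg (by omega),
    attach_genWitness n a r t hn lf rf hg ha (by omega), offAdjPairs_genWitness n a r t hn lf rf hg (by omega)]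
    at hdec
  have hatt : ((range t).filter (fun i => rf i < a + (r - t))).card ≤ t := by
    have := card_le_card (filter_subset (fun i => rf i < a + (r - t)) (range t))
    rw [card_range] at this
    exact this
  have hP : coll t lf + coll t rf ≤ t * (t - 1) := by
    have h1 := offAdjPairs_add_le (missingGraph (genWitness n a r t hn lf rf) (leftPart n a)) (fin' n hn 0)
    rw [offEdges_missingGraph_genWitness n a r t hn lf rf hg (by omega), card_genPairs n a t hn lf rf hg (by omega),
      offAdjPairs_genWitness n a r t hn lf rf hg (by omega)] at h1
    have e : t * t = t * (t - 1) + t := by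
      obtain ⟨t', rfl⟩ : ∃ t', t = t' + 1 := ⟨t - 1, by omega⟩
      rw [Nat.add_sub_cancel]
      ring
    omega
  have h1 : t ≤ r := by omega
  have h2 : 1 ≤ r - t := by omega
  obtain ⟨att, hatt'⟩ : ∃ att, ((range t).filter (fun i => rf i < a + (r - t))).card = att := ⟨_, rfl⟩
  rw [hatt'] at hdec hatt ⊢
  obtain ⟨P, hP'⟩ : ∃ P, coll t lf + coll t rf = P := ⟨_, rfl⟩
  rw [hP'] at hdec hP ⊢
  zify [h1, h2, hatt, hP, ht] at hdec ⊢
  linear_combination hdec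

end C047

end TriangleCap

end PercRepro
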